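import Literature.AlgebraicGeometry.Motives.CurveSymmetricChartInjective
import Literature.NumberTheory.GaloisRepresentations.DivisorClassGaloisAction
import HarnessLib

/-!
# Divisors on `C_F` under field extensions and automorphisms; splittings are permuted
# (towards Milne, *Jacobian Varieties*, Thm. 3.13 at field-valued points — the separable case)

Milne, *Jacobian Varieties*, Thm. 3.13 (`C^{(r)}` represents `Div^r_C`) is proved by descent: a
relative effective divisor splits after a finite flat covering, the split divisor `Σ nᵢ sᵢ` is
classified by the tuple of sections followed by `Cʳ → C^{(r)}`, and the classifying map descends.
At field-valued points and for GALOIS splitting fields the descent is Galois descent; this file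
provides its ingredients (the descent itself is the sequel):

* §0 `bcHom C m : C_{F'} → C_F` for a morphism `m : Spec F' → Spec F` of field points over `k`
  (surjective, an isomorphism for isomorphisms `m`, functorial: `bcHom_comp`), and the honest
  pullback `fieldExtPullback C m D = D_{F'}` of Cartier divisors with `fieldExtPullback_comp`;
* §1a **orders of vanishing are invariant under isomorphisms**:
  `Scheme.ord_functionFieldMap_of_isIso` (`ord_y(g^* f) = ord_{g y}(f)`, discrete valuation rings,
  `addVal` transported along the stalk isomorphism) and `CartierDivisor.ordAt_pullback_of_isIso`;
* §2 tuples: `comp_tuplePt`, `liftOver_perm`, `liftOver_perm_mk` (permuting a tuple does not change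
  its image in `C^{(d)}`, `symPowProj.permOver_mk`), `comp_tuplePt_mk_eq` — an automorphism `s` of
  the field point with `s ≫ Qᵢ = Q_{ρ i}` FIXES the image of `(Q₁, …, Q_d)` in `C^{(d)}`;
* §1b **`exists_perm_of_split`** — if `D_{F'} = Σᵢ [Qᵢ]` (as divisors of the function field of
  `C_{F'}`, `toDivisor`) and the `k`-automorphism `s` of `Spec F'` lies over `Spec F`
  (`s ≫ m = m`), then `s ≫ Qᵢ = Q_{ρ i}` for a permutation `ρ`: `D_{F'}` is invariant under the
  automorphism `C × s` of `C_{F'}` (`fieldExtPullback_comp`), invariant divisors have invariant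
  splittings (`sum_single_place_eq_of_invariant`, through §1a), and equal sums of point masses
  differ by a permutation (`exists_perm_of_sum_single_eq`, `Motives/CurveSymmetricChartInjective`).

Together: for a divisor `D` on `C_F` split over a Galois extension `F'/F` by `F'`-valued points
`Qᵢ`, the point `(Q₁, …, Q_d) ↦ C^{(d)}(F')` is `Gal(F'/F)`-invariant — the input of Galois descent
(Weil's "fundamental theorem on symmetric functions", Lang, *Abelian Varieties*, I §1 p. 8: "obvious
in the case where all the points of `𝔞` are rational over a separable extension of `k`").
Everything is proved; no named facts (D-0026). Part of the construction of the Jacobian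
(`nonempty_jacobian_of_isSmoothProjective`).

## References

* J. S. Milne, *Jacobian Varieties*, in: Arithmetic Geometry (Cornell–Silverman, eds.), Springer
  1986, §3 Thm. 3.13 with its proof (pp. 246–247 of the volume). [Milne1986JacobianVarieties]
* S. Lang, *Abelian Varieties* (1959/1983), Ch. I §1, p. 8. [LangAbelianVarieties]
-/

noncomputable section

open CategoryTheory CategoryTheory.Limits AlgebraicGeometry IsLocalRing
  MonoidalCategory CartesianMonoidalCategory

universe u

namespace Literature.AlgebraicGeometry.Motives

open Literature.AlgebraicGeometry.RelativeSpec CurvePlaces FieldPoint CartierDivisor RatFn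

/-! ### §0 Pullback of divisors along a field extension -/

section FieldExt

variable {k : Type u} [Field k] (C : SchemeOver k)
  {F F' : Type u} [Field F] [Field F'] {π : Spec (.of F) ⟶ Spec (.of k)}
  {π' : Spec (.of F') ⟶ Spec (.of k)} (m : Over.mk π' ⟶ Over.mk π)

/-- The base-change morphism `C_{F'} → C_F` of a morphism `m : Spec F' → Spec F` of field points,
typed between the curves `curveBC`. [folklore] -/
def bcHom : (curveBC C π').left ⟶ (curveBC C π).left := (C ◁ m).left

/-- `bcHom` is `(C ◁ m).left`. [folklore] -/
theorem bcHom_def : bcHom C m = (C ◁ m).left := rfl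

/-- `C_{F'} → C_F` is surjective (base change of `Spec F' → Spec F`). [folklore] -/
instance surjective_bcHom : Surjective (bcHom C m) := by
  have hP := Limits.SubalgApprox.isPullback_whiskerLeft_left C m
  haveI : Surjective m.left :=
    ⟨fun x ↦ ⟨closedPoint F', Subsingleton.elim (α := PrimeSpectrum F) _ _⟩⟩
  exact MorphismProperty.of_isPullback hP.flip inferInstance

/-- `bcHom` of an isomorphism is an isomorphism. [folklore] -/
instance isIso_bcHom (s : Over.mk π' ⟶ Over.mk π') [IsIso s] : IsIso (bcHom C s) := by
  change IsIso ((Over.forget _).map (C ◁ s))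
  infer_instance

/-- `bcHom (m' ≫ m) = bcHom m' ≫ bcHom m`. [folklore] -/
theorem bcHom_comp {F'' : Type u} [Field F''] {π'' : Spec (.of F'') ⟶ Spec (.of k)}
    (m' : Over.mk π'' ⟶ Over.mk π') : bcHom C (m' ≫ m) = bcHom C m' ≫ bcHom C m := by
  change (C ◁ (m' ≫ m)).left = _
  rw [MonoidalCategory.whiskerLeft_comp]
  rfl

variable [IsIntegral C.left] [GeometricallyIntegral C.hom]

/-- **The pullback `D_{F'}` of a Cartier divisor `D` on `C_F` to `C_{F'}`** along a field extension
`F → F'` over `k`. [folklore] -/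
def fieldExtPullback (D : CartierDivisor (curveBC C π).left) : CartierDivisor (curveBC C π').left :=
  D.pullback (bcHom C m)

omit [IsIntegral C.left] in
/-- Transitivity: `D_{F''} = (D_{F'})_{F''}` up to `SameDivisor`. [folklore] -/
theorem fieldExtPullback_comp {F'' : Type u} [Field F''] {π'' : Spec (.of F'') ⟶ Spec (.of k)}
    (m' : Over.mk π'' ⟶ Over.mk π') (D : CartierDivisor (curveBC C π).left) :
    (fieldExtPullback C m' (fieldExtPullback C m D)).SameDivisor (fieldExtPullback C (m' ≫ m) D) := by
  refine (pullback_pullback_sameDivisor D (bcHom C m) (bcHom C m')).trans ?_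
  exact pullback_congr_sameDivisor D (bcHom_comp C m m').symm

end FieldExt

/-! ### §1a Orders of vanishing under isomorphisms -/

section OrdIso

variable {X Y : Scheme.{u}} [IsIntegral X] [IsIntegral Y] (g : Y ⟶ X) [IsIso g]
  [IsLocallyNoetherian X] [IsLocallyNoetherian Y]

/-- `ord_x(u / v) = ord_x(u) − ord_x(v)` (Mathlib `Scheme.ord_mul`). [folklore] -/
theorem Scheme.ord_div' {u v : X.functionField} (hu : u ≠ 0) (hv : v ≠ 0) (x : X) :
    Scheme.ord (u / v) x = Scheme.ord u x - Scheme.ord v x := by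
  have h := Scheme.ord_mul (div_ne_zero hu hv) hv (x := x)
  rw [div_mul_cancel₀ u hv] at h
  omega

/-- **The order of vanishing is invariant under isomorphisms**: for an isomorphism `g : Y ≅ X` of
integral schemes and a point `y` with discrete valuation ring `𝒪_{Y,y}` (so also `𝒪_{X, g y}`),
`ord_y(g^* f) = ord_{g y}(f)`. [folklore] -/
theorem Scheme.ord_functionFieldMap_of_isIso (y : Y)
    [IsDiscreteValuationRing (Y.presheaf.stalk y)] [IsDiscreteValuationRing (X.presheaf.stalk (g y))]
    {f : X.functionField} (hf : f ≠ 0) :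
    Scheme.ord (functionFieldMap g f) y = Scheme.ord f (g y) := by
  haveI : IsIso (g.stalkMap y) := inferInstance
  set e : X.presheaf.stalk (g y) ≃+* Y.presheaf.stalk y := (asIso (g.stalkMap y)).commRingCatIsoToRingEquiv
  obtain ⟨a, b, hb, rfl⟩ := IsFractionRing.div_surjective (A := X.presheaf.stalk (g y)) f
  have hb0 : (b : X.presheaf.stalk (g y)) ≠ 0 := nonZeroDivisors.ne_zero hb
  have ha0 : a ≠ 0 := by
    rintro rfl
    exact hf (by rw [map_zero, zero_div])
  have hinjX := toFunctionField_injective (g y)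
  have hinjY := toFunctionField_injective y
  have haX : toFunctionField (g y) a ≠ 0 := (map_ne_zero_iff _ hinjX).mpr ha0
  have hbX : toFunctionField (g y) b ≠ 0 := (map_ne_zero_iff _ hinjX).mpr hb0
  have hea : e a ≠ 0 := (map_ne_zero_iff _ e.injective).mpr ha0
  have heb : e b ≠ 0 := (map_ne_zero_iff _ e.injective).mpr hb0
  have haY : toFunctionField y (e a) ≠ 0 := (map_ne_zero_iff _ hinjY).mpr hea
  have hbY : toFunctionField y (e b) ≠ 0 := (map_ne_zero_iff _ hinjY).mpr heb
  change Scheme.ord (functionFieldMap g (toFunctionField (g y) a / toFunctionField (g y) b)) y =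
    Scheme.ord (toFunctionField (g y) a / toFunctionField (g y) b) (g y)
  rw [map_div₀, functionFieldMap_toFunctionField, functionFieldMap_toFunctionField]
  change Scheme.ord (toFunctionField y (e a) / toFunctionField y (e b)) y = _
  rw [Scheme.ord_div' haY hbY, Scheme.ord_div' haX hbX, ord_toFunctionField_eq_addVal hea,
    ord_toFunctionField_eq_addVal heb, ord_toFunctionField_eq_addVal ha0,
    ord_toFunctionField_eq_addVal hb0,
    Literature.NumberTheory.GaloisRepresentations.addVal_map_ringEquiv e a,
    Literature.NumberTheory.GaloisRepresentations.addVal_map_ringEquiv e b]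

/-- **`ord_y(g^* E) = ord_{g y}(E)`** for a Cartier divisor `E` and an isomorphism `g`. [folklore] -/
theorem CartierDivisor.ordAt_pullback_of_isIso (E : CartierDivisor X) (y : Y)
    [IsDiscreteValuationRing (Y.presheaf.stalk y)] [IsDiscreteValuationRing (X.presheaf.stalk (g y))] :
    (E.pullback g).ordAt y = E.ordAt (g y) := by
  obtain ⟨i, hi⟩ := E.covers (g y)
  have hi' : y ∈ (E.pullback g).U i := hi
  rw [ordAt_eq_ord _ hi', ordAt_eq_ord _ hi, pullback_f]
  exact Scheme.ord_functionFieldMap_of_isIso g y (E.f_ne_zero i)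

end OrdIso

/-! ### §2 Tuples under permutations and automorphisms of the field point -/

section Tuples

variable {k : Type u} [Field k] (C : SchemeOver k) {d : ℕ}
  {F' : Type u} [Field F'] {π' : Spec (.of F') ⟶ Spec (.of k)}

/-- Naturality of the tuple: `s ≫ (Q₁, …, Q_d) = (s ≫ Q₁, …, s ≫ Q_d)`. [folklore] -/
theorem comp_tuplePt {T : SchemeOver k} (s : T ⟶ Over.mk π') (Q : Fin d → (Over.mk π' ⟶ C)) :
    s ≫ tuplePt C π' Q = liftOver C.hom d fun i ↦ s ≫ Q i := by
  refine hom_ext_projOver C.hom d _ _ fun i ↦ ?_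
  rw [Category.assoc, liftOver_projOver]
  exact congrArg (s ≫ ·) (tuplePt_coord C π' Q i)

/-- A permuted tuple is the tuple followed by the permutation automorphism of `Cᵈ`. [folklore] -/
theorem liftOver_perm {T : SchemeOver k} (Q : Fin d → (T ⟶ C)) (ρ : Equiv.Perm (Fin d)) :
    (liftOver C.hom d fun i ↦ Q (ρ i)) = liftOver C.hom d Q ≫ permOver C.hom d ρ.symm := by
  refine hom_ext_projOver C.hom d _ _ fun i ↦ ?_
  rw [liftOver_projOver, Category.assoc, permOver_projOver, Equiv.symm_symm, liftOver_projOver]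

/-- **Permuting a tuple does not change its image in `C^{(d)}`.** [cite: Milne1986JacobianVarieties, §3 Prop. 3.1] -/
theorem liftOver_perm_mk (hC : IsProjectiveOver C) {T : SchemeOver k} (Q : Fin d → (T ⟶ C))
    (ρ : Equiv.Perm (Fin d)) :
    (liftOver C.hom d fun i ↦ Q (ρ i)) ≫ symPowProj.mk C hC d = liftOver C.hom d Q ≫ symPowProj.mk C hC d := by
  rw [liftOver_perm, Category.assoc, symPowProj.permOver_mk]

/-- **Invariance of the classifying point under automorphisms permuting the tuple**: if an
automorphism `s` of the field point satisfies `s ≫ Qᵢ = Q_{ρ i}`, then `s` fixes the image of the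
tuple in `C^{(d)}`. [cite: Milne1986JacobianVarieties, §3 Thm. 3.13 (proof, descent step)] -/
theorem comp_tuplePt_mk_eq (hC : IsProjectiveOver C) (s : Over.mk π' ⟶ Over.mk π')
    (Q : Fin d → (Over.mk π' ⟶ C)) (ρ : Equiv.Perm (Fin d)) (hs : ∀ i, s ≫ Q i = Q (ρ i)) :
    s ≫ (tuplePt C π' Q ≫ symPowProj.mk C hC d) = tuplePt C π' Q ≫ symPowProj.mk C hC d := by
  have h1 : s ≫ tuplePt C π' Q = liftOver C.hom d fun i ↦ Q (ρ i) := by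
    refine hom_ext_projOver C.hom d _ _ fun i ↦ ?_
    rw [Category.assoc, liftOver_projOver]
    exact (congrArg (s ≫ ·) (tuplePt_coord C π' Q i)).trans (hs i)
  rw [← Category.assoc, h1]
  exact liftOver_perm_mk C hC Q ρ

end Tuples

/-! ### §1b Automorphisms of the field point permute a splitting -/

section Permute

variable {k : Type u} [Field k] (C : SchemeOver k) [IsIntegral C.left] [SmoothOfRelativeDimension 1 C.hom]
  [IsProper C.hom] [GeometricallyIntegral C.hom]
  {F F' : Type u} [Field F] [Field F'] {π : Spec (.of F) ⟶ Spec (.of k)}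
  {π' : Spec (.of F') ⟶ Spec (.of k)} (m : Over.mk π' ⟶ Over.mk π)

omit [IsIntegral C.left] [SmoothOfRelativeDimension 1 C.hom] [IsProper C.hom] [GeometricallyIntegral C.hom] in
/-- The rational point of `s ≫ Q` is mapped by `C × s` to the rational point of `Q`. [folklore] -/
theorem ratPt_comp_whiskerLeft (s : Over.mk π' ⟶ Over.mk π') (Q : Over.mk π' ⟶ C) :
    ratPt C π' (s ≫ Q) ≫ (C ◁ s).left = s.left ≫ ratPt C π' Q := by
  apply pullback.hom_ext
  · change (ratPt C π' (s ≫ Q) ≫ (C ◁ s).left) ≫ fieldPointFst C π' =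
      (s.left ≫ ratPt C π' Q) ≫ fieldPointFst C π'
    erw [Category.assoc, Category.assoc, Over.whiskerLeft_left_fst, ratPt_fst, ratPt_fst]
    rfl
  · change (ratPt C π' (s ≫ Q) ≫ (C ◁ s).left) ≫ fieldPointStr C π' =
      (s.left ≫ ratPt C π' Q) ≫ fieldPointStr C π'
    erw [Category.assoc, Category.assoc, Over.whiskerLeft_left_snd, ratPt_snd_assoc, ratPt_snd]
    try rfl

omit [IsIntegral C.left] [SmoothOfRelativeDimension 1 C.hom] [IsProper C.hom] [GeometricallyIntegral C.hom] in
/-- On points: `(C × s)(pt_{s ≫ Q}) = pt_Q`. [folklore] -/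
theorem bcHom_ratPtPoint (s : Over.mk π' ⟶ Over.mk π') (Q : Over.mk π' ⟶ C) :
    bcHom C s (ratPtPoint C π' (s ≫ Q)) = ratPtPoint C π' Q := by
  rw [bcHom_def]
  have h := congrArg (fun f : Spec (.of F') ⟶ (C ⊗ Over.mk π').left ↦ f (closedPoint F'))
    (ratPt_comp_whiskerLeft C s Q)
  simp only [Scheme.Hom.comp_apply] at h
  refine h.trans ?_
  change ratPt C π' Q (s.left (closedPoint F')) = ratPt C π' Q (closedPoint F')
  congr 1
  exact Subsingleton.elim (α := PrimeSpectrum F') _ _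

/-- `place` does not depend on the proof. [folklore] -/
theorem place_congr {L : Type u} [Field L] (X : SchemeOver L) [IsIntegral X.left]
    [SmoothOfRelativeDimension 1 X.hom] {a b : X.left} (h : a = b) (ha : a ≠ genericPoint X.left)
    (hb : b ≠ genericPoint X.left) : place X a ha = place X b hb := by
  subst h; rfl

/-- An automorphism of a smooth complete curve does not send closed points to the generic point.
[folklore] -/
theorem apply_ne_genericPoint_of_isIso {L : Type u} [Field L] (X : SchemeOver L) [IsIntegral X.left]
    [SmoothOfRelativeDimension 1 X.hom] [IsProper X.hom] (g : X.left ⟶ X.left) [IsIso g]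
    {y : X.left} (hy : y ≠ genericPoint X.left) : g y ≠ genericPoint X.left := by
  intro h
  have hcl : IsClosed ({g y} : Set X.left) := by
    rw [← Set.image_singleton]
    exact g.isClosedMap _ (isClosed_singleton (C := X) hy)
  rw [h] at hcl
  have hdense : closure ({genericPoint X.left} : Set X.left) = (⊤ : Set X.left) :=
    (genericPoint_spec X.left).def
  rw [hcl.closure_eq, Set.top_eq_univ] at hdense
  have : y ∈ ({genericPoint X.left} : Set X.left) := hdense.symm ▸ Set.mem_univ y
  exact hy (Set.eq_of_mem_singleton this)

/-- **Invariant divisors have invariant splittings** (abstract form): for an automorphism `g` of a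
smooth complete curve `X` with `g^* E = E` and `E = Σᵢ [qᵢ]`, and points `yᵢ` with `g yᵢ = qᵢ`,
also `E = Σᵢ [yᵢ]`. [folklore] -/
theorem sum_single_place_eq_of_invariant {L : Type u} [Field L] (X : SchemeOver L) [IsIntegral X.left]
    [SmoothOfRelativeDimension 1 X.hom] [IsProper X.hom] (g : X.left ⟶ X.left) [IsIso g]
    (E : CartierDivisor X.left) (hE : toDivisor X (E.pullback g) = toDivisor X E) {d : ℕ}
    (q y : Fin d → X.left) (hq : ∀ i, q i ≠ genericPoint X.left) (hy : ∀ i, y i ≠ genericPoint X.left)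
    (hgy : ∀ i, g (y i) = q i)
    (hsplit : toDivisor X E = ∑ i, Finsupp.single (place X (q i) (hq i)) 1) :
    ∑ i, Finsupp.single (place X (q i) (hq i)) (1 : ℤ) = ∑ i, Finsupp.single (place X (y i) (hy i)) 1 := by
  classical
  have hginj : Function.Injective g := (Scheme.homeoOfIso (asIso g)).injective
  -- `E(place z) = E(place (g z))`
  have key : ∀ (z : X.left) (hz : z ≠ genericPoint X.left),
      toDivisor X E (place X z hz) = toDivisor X E (place X (g z) (apply_ne_genericPoint_of_isIso X g hz)) := by
    intro z hz
    have hgz := apply_ne_genericPoint_of_isIso X g hz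
    haveI := isDiscreteValuationRing_stalk X hz
    haveI := isDiscreteValuationRing_stalk X hgz
    conv_lhs => rw [← hE]
    rw [toDivisor_place, toDivisor_place]
    exact ordAt_pullback_of_isIso g E z
  ext v
  have hz : pointOfPlace (C := X) v ≠ genericPoint X.left := pointOfPlace_ne_genericPoint v
  have hv : place X _ hz = v := place_pointOfPlace v
  have h1 : (∑ i, Finsupp.single (place X (q i) (hq i)) (1 : ℤ)) v =
      toDivisor X E (place X (g _) (apply_ne_genericPoint_of_isIso X g hz)) := by
    rw [← hsplit, ← key _ hz, hv]
  rw [h1, hsplit]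
  simp only [Finsupp.coe_finsetSum, Finset.sum_apply, Finsupp.single_apply]
  refine Finset.sum_congr rfl fun i _ ↦ ?_
  have hiff : place X (q i) (hq i) = place X (g _) (apply_ne_genericPoint_of_isIso X g hz) ↔
      place X (y i) (hy i) = v := by
    constructor
    · intro h
      have h' := place_injective (C := X) _ _ h
      rw [← hgy i] at h'
      rw [← hv]
      exact place_congr X (hginj h') _ _
    · intro h
      have h' := place_injective (C := X) _ _ (h.trans hv.symm)
      exact place_congr X ((hgy i).symm.trans (congrArg g h')) _ _
  exact if_congr hiff rfl rfl

omit [IsIntegral C.left] in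
/-- **An automorphism of the field point fixing the divisor permutes any splitting**: if
`D_{F'} = Σᵢ [Qᵢ]` and the `k`-automorphism `s` of `Spec F'` lies over `Spec F` (`s ≫ m = m`), then
`s ≫ Qᵢ = Q_{ρ i}` for a permutation `ρ` (the divisor `D_{F'}` is `(C × s)`-invariant, and orders
of vanishing are preserved by the automorphism `C × s` of `C_{F'}`). [cite: Milne1986JacobianVarieties, §3 Thm. 3.13 (proof, descent step)] -/
theorem exists_perm_of_split {d : ℕ} (D : CartierDivisor (curveBC C π).left)
    (Q : Fin d → (Over.mk π' ⟶ C))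
    (hsplit : toDivisor (curveBC C π') (fieldExtPullback C m D) =
      ∑ i, Finsupp.single (place (curveBC C π') (ratPtPoint C π' (Q i))
        (ratPtPoint_ne_genericPoint C _ _)) 1)
    (s : Over.mk π' ⟶ Over.mk π') [IsIso s] (hs : s ≫ m = m) :
    ∃ ρ : Equiv.Perm (Fin d), ∀ i, s ≫ Q i = Q (ρ i) := by
  classical
  -- `(C × s)^* D_{F'} = D_{F'}` as divisors of the function field
  have hinv : toDivisor (curveBC C π') ((fieldExtPullback C m D).pullback (bcHom C s)) =
      toDivisor (curveBC C π') (fieldExtPullback C m D) := by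
    apply SameDivisor.toDivisor_eq
    refine (fieldExtPullback_comp C m s D).trans ?_
    exact pullback_congr_sameDivisor D (by rw [hs])
  have hsum := sum_single_place_eq_of_invariant (curveBC C π') (bcHom C s) (fieldExtPullback C m D)
    hinv (fun i ↦ ratPtPoint C π' (Q i)) (fun i ↦ ratPtPoint C π' (s ≫ Q i))
    (fun i ↦ ratPtPoint_ne_genericPoint C _ _) (fun i ↦ ratPtPoint_ne_genericPoint C _ _)
    (fun i ↦ bcHom_ratPtPoint C s (Q i)) hsplit
  obtain ⟨ρ, hρ⟩ := exists_perm_of_sum_single_eq _ _ hsum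
  refine ⟨ρ, fun i ↦ ?_⟩
  have h := place_injective (C := curveBC C π') _ _ (hρ i)
  exact ratPtPoint_injective C π' h

end Permute

end Literature.AlgebraicGeometry.Motives
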